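import Mathlib
import Summits.ResolutionOfSingularities.ResolutionOfSingularities.Theorems.WildQuotientsWildQuotientResolutionToricChartCover
import Summits.ResolutionOfSingularities.ResolutionOfSingularities.Theorems.WildQuotientsWildQuotientResolutionQuarter1123Defs

/-!
# The `μ₄` vertex piece of `Y(J₅)`: ONE blow-up of `¼(1,1,2,3) × 𝔸^P` along `I_A^{(3)}` is regular

(crux stmt-ResolutionOfSingularities-15640 `WildQuotients.WildQuotientResolution`, line `Sketch`,
sector `|G| = p`; next rung R-T J₅ of `L/w45c/CHAIN.md` v8 §5 (III) — the cone lane; the `μ₄`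
vertex is RT-LADDER's «where it first fails» for the canonical `Bl_{Sing_red}`-iteration (depth 2);
here a ONE-SHOT exit along the third symbolic power of the reduced singular axis, an INTRINSIC
centre (so the future `J₅` assembly needs no gluing of local fans: off the `x₀`-vertex stratum
`I^{(3)} = I³` has the same blow-up as `I`). [OURS · L1 W4.5c] — NOT a statement of any manuscript;
replaces the role of no printed item. Prover res-L1-w45c-stub-4 (gen 4).)

* `Quarter1123.check_cert`, `Quarter1123.check_rel` — the ten chart certificates and the 38 Rees
  relations of `…Quarter1123Defs` are valid (kernel evaluation, `decide`);
* `Quarter1123.blowup_regular` — for every field `k` and finite passenger type `P`, the blow-up of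
  the presented cone ring `A = k[Y] ⧸ ker (ToricChart.presentation k P quarterDatum)`
  (`≅ k[s,t,u,v]^{μ₄} ⊗ k[P]`) along the ideal of the 38 generator classes is a REGULAR scheme,
  integral, and proper birational over `Spec A` (`ToricChart.blowup_regular_of_certificates`).
-/

-- single-problem summit: the doubled namespace component `ResolutionOfSingularities` is forced
set_option linter.dupNamespace false

noncomputable section

open AlgebraicGeometry CategoryTheory
open Literature.AlgebraicGeometry.Resolution

namespace Summit.ResolutionOfSingularities.ResolutionOfSingularities.Theorems.WildQuotientResolution.Quarter1123

open ToricChart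

-- the kernel evaluation of the certificate checker nests deeper than the default 512
set_option maxRecDepth 8000 in
/-- **The ten chart certificates are valid** (kernel check). [OURS · L1 W4.5c] -/
theorem check_cert : ∀ j : Fin 10,
    (quarterCert j).check quarterDatum quarterGens (quarterVtx j) = true := by
  decide

set_option maxRecDepth 8000 in
/-- **The 38 Rees relation certificates are valid** (kernel check). [OURS · L1 W4.5c] -/
theorem check_rel : ∀ l : Fin 38,
    (quarterRel l).check quarterDatum quarterGens l (quarterVtx (quarterVidx l)) = true := by
  decide

/-- **One blow-up resolves the `μ₄` vertex piece `¼(1,1,2,3) × 𝔸^P`**: the blow-up of the presented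
cone ring along `I_A^{(3)}` (the 38 generator classes `wordElem (quarterGens i)`) is regular,
integral, proper and birational — ten affine-space vertex charts. [OURS · L1 W4.5c] -/
theorem blowup_regular (k : Type) [Field k] (P : Type) [Finite P] :
    Scheme.IsRegular (affineBlowup (Ideal.span (Set.range fun i : Fin 38 =>
        wordElem k P quarterDatum (quarterGens i)))) ∧
      IsIntegral (affineBlowup (Ideal.span (Set.range fun i : Fin 38 =>
        wordElem k P quarterDatum (quarterGens i)))) ∧
      IsProper (affineBlowup.π (Ideal.span (Set.range fun i : Fin 38 =>
        wordElem k P quarterDatum (quarterGens i)))) ∧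
      IsBirational (affineBlowup.π (Ideal.span (Set.range fun i : Fin 38 =>
        wordElem k P quarterDatum (quarterGens i)))) :=
  blowup_regular_of_certificates k P quarterDatum quarterGens (by norm_num) quarterVtx quarterVidx
    quarterCert quarterRel check_cert check_rel

end Summit.ResolutionOfSingularities.ResolutionOfSingularities.Theorems.WildQuotientResolution.Quarter1123

end
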